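import Summits.ValiantsHypothesis.ValiantsHypothesis.Theorems.SymPencilSdcPerFourCellTenSix
import Summits.ValiantsHypothesis.ValiantsHypothesis.Theorems.SymPencilSdcPerFourCellTenSixShapes
import Summits.ValiantsHypothesis.ValiantsHypothesis.Theorems.SymPencilSdcPerFourCellTenSevenShapes
import Summits.ValiantsHypothesis.ValiantsHypothesis.Theorems.SymPencilBasePointDetConst
import Summits.ValiantsHypothesis.ValiantsHypothesis.Theorems.SymPencilPerFourBasePointPackage

/-!
# Route `SymPencil` — row `r = 10` of the size-`28` table: the threshold-shifted declarations of
# `SymPencilSdcPerFourCellTenSix` (`--supports` stmt-ValiantsHypothesis-5674 `SdcSuperquadratic`; rung currency only)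

The declarations below (suffix `_m28`) are those of the landed `…Theorems.SymPencilSdcPerFourCellTenSix` whose meaning
changes when its numerical thresholds move by one unit — `Fin 6 → Fin 7` square families /
`|ι'| ≤ 26 → ≤ 27` / `m ≤ 27 → m ≤ 28`, as applicable — with proofs VERBATIM; unchanged
declarations are used from the original module by name (same namespace).  Why it elaborates
(m = 28 table audit, val-lit-p6 g17, 2026-08-29; reader of record val-idea-crit-5 g4, probe P31):
the leaves of the `(10, 6)` chain are stated for `card ι < 8` / `< 9`, and every size lever reads
`4·rk bL ≤ 2·dim K + |ι'|` through integer division — one unit of slack throughout.  The `_m28`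
statements imply the landed ones.

Honest framing: part of ONE row (cell `(10, 6, 7)`) of the size-`28` table; nothing about
`sdc(per_4)` follows here; `28 ≤ sdc(per_4) ≤ 29` of record, the crux `SdcSuperquadratic` and
`VP ≠ VNP` untouched.  Credit: mathematics and proof text of `SymPencilSdcPerFourCellTenSix` (its authors); this file only
moves the bound.  No definitions, no named facts. [folklore]
-/

noncomputable section

-- single-conjunct layout: Sub = Summit, duplicated namespace component intended
set_option linter.dupNamespace false

namespace Summit.ValiantsHypothesis.ValiantsHypothesis.Theorems.SymPencilSdcPerFourCellTenSeven

open Summit.ValiantsHypothesis.ValiantsHypothesis.Theorems.SymPencilSdcPerFourCellTenSix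

open Matrix MvPolynomial Module
open Literature.Computability.AlgebraicComplexity
open Summit.ValiantsHypothesis.ValiantsHypothesis.Theorems.SymPencilSdcPerFourCellTenSixShapes
open Summit.ValiantsHypothesis.ValiantsHypothesis.Theorems.SymPencilBasePointDetConst
open Summit.ValiantsHypothesis.ValiantsHypothesis.Theorems.SymPencilIsotropicKernelSquaresBilinear
open Summit.ValiantsHypothesis.ValiantsHypothesis.Theorems.SymPencilBoxFourEquality

universe u

variable {k : Type u} [Field k]

/-! ## The cell theorem -/

section Cell

variable [CharZero k] {ι' : Type*} [Fintype ι'] [DecidableEq ι']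

omit [CharZero k] in
/-- **The per-direction LIST implies the joint LIST**: a joint family of six squares on `W` is in
particular a per-direction family of `≤ 6` squares for every `y ∈ W` (`Λ_k = β_k(·, y)`), so the
conclusion of the crux workfile's `sixDim_perDir_list_m28` (hypotheses `Sing3 W`, `finrank W = 6`,
`(∀ y ∈ W, ∃ (c : Fin 7 → K) (Λ : Fin 7 → ((Fin 4 × Fin 4 → K) →ₗ[K] K)),
        ∀ u : Fin 4 × Fin 4 → K, ∃ e₀ e₁ : K, ∀ s : K,
          eval (u + s • y) (perPoly (Fin 4) K) = e₀ + s * e₁ + s ^ 2 * ∑ k, c k * (Λ k u) ^ 2)`, all unfolded here) gives the weaker-hypothesis form used by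
`false_of_rank_ten_of_list_m28`. [folklore] -/
theorem jointList_of_perDirList_m28
    (hP : ∀ W : Submodule k (Fin 4 × Fin 4 → k),
      (∀ x ∈ W, ∀ (r c : Fin 3 → Fin 4), Function.Injective r → Function.Injective c →
        ((Matrix.of fun i j => x (i, j)).submatrix r c).permanent = 0) →
      finrank k W = 6 →
      (∀ y ∈ W, ∃ (c : Fin 7 → k) (Λ : Fin 7 → ((Fin 4 × Fin 4 → k) →ₗ[k] k)),
        ∀ u : Fin 4 × Fin 4 → k, ∃ e₀ e₁ : k, ∀ s : k,
          eval (u + s • y) (perPoly (Fin 4) k) = e₀ + s * e₁ + s ^ 2 * ∑ j, c j * (Λ j u) ^ 2) →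
      (∃ (l c : Fin 4) (e : Fin 4 × Fin 4), (e.1 = l ∨ e.2 = c) ∧ e ≠ (l, c) ∧
          ∀ x : Fin 4 × Fin 4 → k, x ∈ W ↔
            ((∀ i j : Fin 4, i ≠ l → j ≠ c → x (i, j) = 0) ∧ x e = 0)) ∨
      (∃ p q m : Fin 4, p ≠ q ∧ ∀ x : Fin 4 × Fin 4 → k, x ∈ W ↔
          ((∀ i j : Fin 4, i ≠ p → i ≠ q → x (i, j) = 0) ∧ x (p, m) = 0 ∧ x (q, m) = 0)) ∨
      (∃ p q m m' : Fin 4, p ≠ q ∧ m ≠ m' ∧ ∀ x : Fin 4 × Fin 4 → k, x ∈ W ↔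
          ((∀ i j : Fin 4, i ≠ p → i ≠ q → x (i, j) = 0) ∧ x (q, m) = 0 ∧ x (q, m') = 0)) ∨
      (∃ p q m : Fin 4, p ≠ q ∧ ∀ x : Fin 4 × Fin 4 → k, x ∈ W ↔
          ((∀ i j : Fin 4, j ≠ p → j ≠ q → x (i, j) = 0) ∧ x (m, p) = 0 ∧ x (m, q) = 0)) ∨
      (∃ p q m m' : Fin 4, p ≠ q ∧ m ≠ m' ∧ ∀ x : Fin 4 × Fin 4 → k, x ∈ W ↔
          ((∀ i j : Fin 4, j ≠ p → j ≠ q → x (i, j) = 0) ∧ x (m, q) = 0 ∧ x (m', q) = 0))) :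
    ∀ W : Submodule k (Fin 4 × Fin 4 → k),
      (∀ x ∈ W, ∀ (r c : Fin 3 → Fin 4), Function.Injective r → Function.Injective c →
        ((Matrix.of fun i j => x (i, j)).submatrix r c).permanent = 0) →
      finrank k W = 6 →
      (∃ (c : Fin 7 → k) (β : Fin 7 → ((Fin 4 × Fin 4 → k) →ₗ[k] (Fin 4 × Fin 4 → k) →ₗ[k] k)),
        ∀ u : Fin 4 × Fin 4 → k, ∀ y ∈ W, ∃ e₀ e₁ : k, ∀ s : k,
          eval (u + s • y) (perPoly (Fin 4) k) = e₀ + s * e₁ + s ^ 2 * ∑ j, c j * (β j u y) ^ 2) →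
      (∃ (l c : Fin 4) (e : Fin 4 × Fin 4), (e.1 = l ∨ e.2 = c) ∧ e ≠ (l, c) ∧
          ∀ x : Fin 4 × Fin 4 → k, x ∈ W ↔
            ((∀ i j : Fin 4, i ≠ l → j ≠ c → x (i, j) = 0) ∧ x e = 0)) ∨
      (∃ p q m : Fin 4, p ≠ q ∧ ∀ x : Fin 4 × Fin 4 → k, x ∈ W ↔
          ((∀ i j : Fin 4, i ≠ p → i ≠ q → x (i, j) = 0) ∧ x (p, m) = 0 ∧ x (q, m) = 0)) ∨
      (∃ p q m m' : Fin 4, p ≠ q ∧ m ≠ m' ∧ ∀ x : Fin 4 × Fin 4 → k, x ∈ W ↔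
          ((∀ i j : Fin 4, i ≠ p → i ≠ q → x (i, j) = 0) ∧ x (q, m) = 0 ∧ x (q, m') = 0)) ∨
      (∃ p q m : Fin 4, p ≠ q ∧ ∀ x : Fin 4 × Fin 4 → k, x ∈ W ↔
          ((∀ i j : Fin 4, j ≠ p → j ≠ q → x (i, j) = 0) ∧ x (m, p) = 0 ∧ x (m, q) = 0)) ∨
      (∃ p q m m' : Fin 4, p ≠ q ∧ m ≠ m' ∧ ∀ x : Fin 4 × Fin 4 → k, x ∈ W ↔
          ((∀ i j : Fin 4, j ≠ p → j ≠ q → x (i, j) = 0) ∧ x (m, q) = 0 ∧ x (m', q) = 0)) := by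
  intro W hS h6 hJ
  obtain ⟨c, β, hcβ⟩ := hJ
  refine hP W hS h6 fun y hy => ⟨c, fun j => (β j).flip y, fun u => ?_⟩
  obtain ⟨e₀, e₁, he⟩ := hcβ u y hy
  exact ⟨e₀, e₁, fun s => by simpa only [LinearMap.flip_apply] using he s⟩
/-- **The cell `(10, 6, 6)` is empty modulo the (joint) LIST.**  See the module docstring.
Hypotheses: the base-point package identities (`hD … hN`), the singularity of the kernel space
(`hV3`), determinant constancy along the kernel (`hdet`), the LIST (`hlist`), rank–nullity, rank
`10`, and `|ι'| ≤ 27`. [folklore] -/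
theorem false_of_rank_ten_of_list_m28 {D : Matrix ι' ι' k} (hD : IsUnit D.det) (hDs : Dᵀ = D)
    (bL : (Fin 4 × Fin 4 → k) →ₗ[k] (ι' → k)) (CL : (Fin 4 × Fin 4 → k) →ₗ[k] Matrix ι' ι' k)
    (hCs : ∀ z, (CL z)ᵀ = CL z) {κ : k} (hκ : κ ≠ 0)
    (hi : ∀ z, bL z ⬝ᵥ D⁻¹ *ᵥ bL z = 0)
    (hii : ∀ z, bL z ⬝ᵥ (D⁻¹ * CL z * D⁻¹) *ᵥ bL z = 0)
    (hiii : ∀ z, D.det * (bL z ⬝ᵥ (D⁻¹ * CL z * D⁻¹ * CL z * D⁻¹) *ᵥ bL z) =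
      -(κ * eval z (perPoly (Fin 4) k)))
    (hN : ∀ v, bL v = 0 → IsUnit (D + CL v).det ∧ ∀ (z : Fin 4 × Fin 4 → k) (s : k),
      κ * MvPolynomial.eval (v + s • z) (perPoly (Fin 4) k) =
        (Matrix.fromBlocks ((s * 0) • (1 : Matrix Unit Unit k))
          (Matrix.replicateRow Unit (s • bL z)) (Matrix.replicateCol Unit (s • bL z))
          (D + CL v + s • CL z)).det)
    (hV3 : ∀ x, bL x = 0 → ∀ (r c : Fin 3 → Fin 4), Function.Injective r →
      Function.Injective c → ((Matrix.of fun i j => x (i, j)).submatrix r c).permanent = 0)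
    (hdet : ∀ v, bL v = 0 → ∀ t : k, (D + t • CL v).det = D.det)
    (hlist : ∀ W : Submodule k (Fin 4 × Fin 4 → k),
      (∀ x ∈ W, ∀ (r c : Fin 3 → Fin 4), Function.Injective r → Function.Injective c →
        ((Matrix.of fun i j => x (i, j)).submatrix r c).permanent = 0) →
      finrank k W = 6 →
      (∃ (c : Fin 7 → k) (β : Fin 7 → ((Fin 4 × Fin 4 → k) →ₗ[k] (Fin 4 × Fin 4 → k) →ₗ[k] k)),
        ∀ u : Fin 4 × Fin 4 → k, ∀ y ∈ W, ∃ e₀ e₁ : k, ∀ s : k,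
          eval (u + s • y) (perPoly (Fin 4) k) = e₀ + s * e₁ + s ^ 2 * ∑ j, c j * (β j u y) ^ 2) →
      (∃ (l c : Fin 4) (e : Fin 4 × Fin 4), (e.1 = l ∨ e.2 = c) ∧ e ≠ (l, c) ∧
          ∀ x : Fin 4 × Fin 4 → k, x ∈ W ↔
            ((∀ i j : Fin 4, i ≠ l → j ≠ c → x (i, j) = 0) ∧ x e = 0)) ∨
      (∃ p q m : Fin 4, p ≠ q ∧ ∀ x : Fin 4 × Fin 4 → k, x ∈ W ↔
          ((∀ i j : Fin 4, i ≠ p → i ≠ q → x (i, j) = 0) ∧ x (p, m) = 0 ∧ x (q, m) = 0)) ∨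
      (∃ p q m m' : Fin 4, p ≠ q ∧ m ≠ m' ∧ ∀ x : Fin 4 × Fin 4 → k, x ∈ W ↔
          ((∀ i j : Fin 4, i ≠ p → i ≠ q → x (i, j) = 0) ∧ x (q, m) = 0 ∧ x (q, m') = 0)) ∨
      (∃ p q m : Fin 4, p ≠ q ∧ ∀ x : Fin 4 × Fin 4 → k, x ∈ W ↔
          ((∀ i j : Fin 4, j ≠ p → j ≠ q → x (i, j) = 0) ∧ x (m, p) = 0 ∧ x (m, q) = 0)) ∨
      (∃ p q m m' : Fin 4, p ≠ q ∧ m ≠ m' ∧ ∀ x : Fin 4 × Fin 4 → k, x ∈ W ↔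
          ((∀ i j : Fin 4, j ≠ p → j ≠ q → x (i, j) = 0) ∧ x (m, q) = 0 ∧ x (m', q) = 0)))
    (hrn : finrank k (LinearMap.range bL) + finrank k (LinearMap.ker bL) = 16)
    (h10 : finrank k (LinearMap.range bL) = 10) (hcard : Fintype.card ι' ≤ 27) : False := by
  classical
  -- the JOINT six-square family on the kernel space (defect `26 - 2·10 = 6`)
  obtain ⟨c, β, hcβ⟩ := sum_sq_of_isotropic_defect_bilinear hD hDs bL CL hCs
    (fun z => eval z (perPoly (Fin 4) k)) hκ hi hii hiii 7 (by omega)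
  have h6 : finrank k (LinearMap.ker bL) = 6 := by omega
  have hmem : ∀ x : Fin 4 × Fin 4 → k, x ∈ LinearMap.ker bL ↔ bL x = 0 := fun x =>
    LinearMap.mem_ker
  rcases hlist (LinearMap.ker bL) (fun x hx => hV3 x (LinearMap.mem_ker.1 hx)) h6
      ⟨c, β, fun u y hy => hcβ u y (LinearMap.mem_ker.1 hy)⟩ with
    ⟨l, c₀, e, harm, hne, hW⟩ | ⟨p, q, m, hpq, hW⟩ | ⟨p, q, m, m', hpq, hmm, hW⟩ |
      ⟨p, q, m, hpq, hW⟩ | ⟨p, q, m, m', hpq, hmm, hW⟩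
  · exact false_of_ker_crossType_m28 hD hDs bL CL hCs hκ hii hN h10.ge hcard hdet l c₀ e harm hne
      (fun x => by rw [← hmem]; exact hW x)
  · exact false_of_ker_colType_m28 hD hDs bL CL hCs hκ hi hii hN h10.ge hcard p q m hpq
      (fun x => by rw [← hmem]; exact hW x)
  · exact false_of_ker_w2Type_m28 hD hDs bL CL hCs hκ hi hii hN h10.ge hcard p q m m' hpq hmm
      (fun x => by rw [← hmem]; exact hW x)
  · exact false_of_ker_colTypeT_m28 hD hDs bL CL hCs hκ hi hii hN h10.ge hcard p q m hpq
      (fun x => by rw [← hmem]; exact hW x)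
  · exact false_of_ker_w2TypeT_m28 hD hDs bL CL hCs hκ hi hii hN h10.ge hcard p q m m' hpq hmm
      (fun x => by rw [← hmem]; exact hW x)
/-- **The cell `(10, 6, 6)` is empty modulo the LIST, over an algebraically closed field** (the
determinant constancy along the kernel is then automatic,
`SymPencilBasePointDetConst.det_add_smul_eq_det_of_isAlgClosed`). [folklore] -/
theorem false_of_rank_ten_of_list_of_isAlgClosed_m28 [IsAlgClosed k] {D : Matrix ι' ι' k}
    (hD : IsUnit D.det) (hDs : Dᵀ = D)
    (bL : (Fin 4 × Fin 4 → k) →ₗ[k] (ι' → k)) (CL : (Fin 4 × Fin 4 → k) →ₗ[k] Matrix ι' ι' k)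
    (hCs : ∀ z, (CL z)ᵀ = CL z) {κ : k} (hκ : κ ≠ 0)
    (hi : ∀ z, bL z ⬝ᵥ D⁻¹ *ᵥ bL z = 0)
    (hii : ∀ z, bL z ⬝ᵥ (D⁻¹ * CL z * D⁻¹) *ᵥ bL z = 0)
    (hiii : ∀ z, D.det * (bL z ⬝ᵥ (D⁻¹ * CL z * D⁻¹ * CL z * D⁻¹) *ᵥ bL z) =
      -(κ * eval z (perPoly (Fin 4) k)))
    (hN : ∀ v, bL v = 0 → IsUnit (D + CL v).det ∧ ∀ (z : Fin 4 × Fin 4 → k) (s : k),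
      κ * MvPolynomial.eval (v + s • z) (perPoly (Fin 4) k) =
        (Matrix.fromBlocks ((s * 0) • (1 : Matrix Unit Unit k))
          (Matrix.replicateRow Unit (s • bL z)) (Matrix.replicateCol Unit (s • bL z))
          (D + CL v + s • CL z)).det)
    (hV3 : ∀ x, bL x = 0 → ∀ (r c : Fin 3 → Fin 4), Function.Injective r →
      Function.Injective c → ((Matrix.of fun i j => x (i, j)).submatrix r c).permanent = 0)
    (hlist : ∀ W : Submodule k (Fin 4 × Fin 4 → k),
      (∀ x ∈ W, ∀ (r c : Fin 3 → Fin 4), Function.Injective r → Function.Injective c →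
        ((Matrix.of fun i j => x (i, j)).submatrix r c).permanent = 0) →
      finrank k W = 6 →
      (∃ (c : Fin 7 → k) (β : Fin 7 → ((Fin 4 × Fin 4 → k) →ₗ[k] (Fin 4 × Fin 4 → k) →ₗ[k] k)),
        ∀ u : Fin 4 × Fin 4 → k, ∀ y ∈ W, ∃ e₀ e₁ : k, ∀ s : k,
          eval (u + s • y) (perPoly (Fin 4) k) = e₀ + s * e₁ + s ^ 2 * ∑ j, c j * (β j u y) ^ 2) →
      (∃ (l c : Fin 4) (e : Fin 4 × Fin 4), (e.1 = l ∨ e.2 = c) ∧ e ≠ (l, c) ∧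
          ∀ x : Fin 4 × Fin 4 → k, x ∈ W ↔
            ((∀ i j : Fin 4, i ≠ l → j ≠ c → x (i, j) = 0) ∧ x e = 0)) ∨
      (∃ p q m : Fin 4, p ≠ q ∧ ∀ x : Fin 4 × Fin 4 → k, x ∈ W ↔
          ((∀ i j : Fin 4, i ≠ p → i ≠ q → x (i, j) = 0) ∧ x (p, m) = 0 ∧ x (q, m) = 0)) ∨
      (∃ p q m m' : Fin 4, p ≠ q ∧ m ≠ m' ∧ ∀ x : Fin 4 × Fin 4 → k, x ∈ W ↔
          ((∀ i j : Fin 4, i ≠ p → i ≠ q → x (i, j) = 0) ∧ x (q, m) = 0 ∧ x (q, m') = 0)) ∨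
      (∃ p q m : Fin 4, p ≠ q ∧ ∀ x : Fin 4 × Fin 4 → k, x ∈ W ↔
          ((∀ i j : Fin 4, j ≠ p → j ≠ q → x (i, j) = 0) ∧ x (m, p) = 0 ∧ x (m, q) = 0)) ∨
      (∃ p q m m' : Fin 4, p ≠ q ∧ m ≠ m' ∧ ∀ x : Fin 4 × Fin 4 → k, x ∈ W ↔
          ((∀ i j : Fin 4, j ≠ p → j ≠ q → x (i, j) = 0) ∧ x (m, q) = 0 ∧ x (m', q) = 0)))
    (hrn : finrank k (LinearMap.range bL) + finrank k (LinearMap.ker bL) = 16)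
    (h10 : finrank k (LinearMap.range bL) = 10) (hcard : Fintype.card ι' ≤ 27) : False :=
  false_of_rank_ten_of_list_m28 hD hDs bL CL hCs hκ hi hii hiii hN hV3
    (fun v hv t => det_add_smul_eq_det_of_isAlgClosed D bL CL (fun w hw => (hN w hw).1) v hv t)
    hlist hrn h10 hcard
end Cell

/-! ## In the coordinates of the base-point package of a representation of size `m ≤ 27` -/

/-- **No base-point package of a symmetric affine determinantal representation of `per_4` of size
`m ≤ 27` has `dim (im bL) = 10`, modulo the LIST** — the form consumed by a future
`28 ≤ sdc(per₄)` assembly (hypotheses exactly as exported by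
`SymPencilPerFourBasePointPackage.basepoint_package_of_isSymm_isAffineDetRepr_perPoly_four`, over
an algebraically closed field of characteristic `0`; size bounds descend to any field of
characteristic `0` by `SymPencilBasePointDetConst.le_size_of_algebraicClosure`). [folklore] -/
theorem false_of_rank_ten_le_twentyEight (K : Type*) [Field K] [CharZero K] [IsAlgClosed K]
    {m : ℕ} (hm : m ≤ 28)
    {i₀ : Fin m} {D : Matrix {i // i ≠ i₀} {i // i ≠ i₀} K}
    {bL : (Fin 4 × Fin 4 → K) →ₗ[K] ({i // i ≠ i₀} → K)}
    {CL : (Fin 4 × Fin 4 → K) →ₗ[K] Matrix {i // i ≠ i₀} {i // i ≠ i₀} K} {κ : K}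
    (hD : IsUnit D.det) (hDs : Dᵀ = D) (hCs : ∀ z, (CL z)ᵀ = CL z) (hκ : κ ≠ 0)
    (hi : ∀ z, bL z ⬝ᵥ D⁻¹ *ᵥ bL z = 0)
    (hii : ∀ z, bL z ⬝ᵥ (D⁻¹ * CL z * D⁻¹) *ᵥ bL z = 0)
    (hiii : ∀ z, D.det * (bL z ⬝ᵥ (D⁻¹ * CL z * D⁻¹ * CL z * D⁻¹) *ᵥ bL z) =
      -(κ * eval z (perPoly (Fin 4) K)))
    (hV4 : ∀ x ∈ LinearMap.ker bL, ∀ r c : Fin 4,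
      ((Matrix.of fun i j => x (i, j)).submatrix r.succAbove c.succAbove).permanent = 0)
    (hcard : Fintype.card {i // i ≠ i₀} + 1 = m)
    (hrn : finrank K (LinearMap.range bL) + finrank K (LinearMap.ker bL) = 16)
    (hN : ∀ v, bL v = 0 → IsUnit (D + CL v).det ∧ ∀ (z : Fin 4 × Fin 4 → K) (s : K),
      κ * eval (v + s • z) (perPoly (Fin 4) K) =
        (Matrix.fromBlocks ((s * 0) • (1 : Matrix Unit Unit K))
          (Matrix.replicateRow Unit (s • bL z)) (Matrix.replicateCol Unit (s • bL z))
          (D + CL v + s • CL z)).det)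
    (hlist : ∀ W : Submodule K (Fin 4 × Fin 4 → K),
      (∀ x ∈ W, ∀ (r c : Fin 3 → Fin 4), Function.Injective r → Function.Injective c →
        ((Matrix.of fun i j => x (i, j)).submatrix r c).permanent = 0) →
      finrank K W = 6 →
      (∃ (c : Fin 7 → K) (β : Fin 7 → ((Fin 4 × Fin 4 → K) →ₗ[K] (Fin 4 × Fin 4 → K) →ₗ[K] K)),
        ∀ u : Fin 4 × Fin 4 → K, ∀ y ∈ W, ∃ e₀ e₁ : K, ∀ s : K,
          eval (u + s • y) (perPoly (Fin 4) K) = e₀ + s * e₁ + s ^ 2 * ∑ j, c j * (β j u y) ^ 2) →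
      (∃ (l c : Fin 4) (e : Fin 4 × Fin 4), (e.1 = l ∨ e.2 = c) ∧ e ≠ (l, c) ∧
          ∀ x : Fin 4 × Fin 4 → K, x ∈ W ↔
            ((∀ i j : Fin 4, i ≠ l → j ≠ c → x (i, j) = 0) ∧ x e = 0)) ∨
      (∃ p q m : Fin 4, p ≠ q ∧ ∀ x : Fin 4 × Fin 4 → K, x ∈ W ↔
          ((∀ i j : Fin 4, i ≠ p → i ≠ q → x (i, j) = 0) ∧ x (p, m) = 0 ∧ x (q, m) = 0)) ∨
      (∃ p q m m' : Fin 4, p ≠ q ∧ m ≠ m' ∧ ∀ x : Fin 4 × Fin 4 → K, x ∈ W ↔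
          ((∀ i j : Fin 4, i ≠ p → i ≠ q → x (i, j) = 0) ∧ x (q, m) = 0 ∧ x (q, m') = 0)) ∨
      (∃ p q m : Fin 4, p ≠ q ∧ ∀ x : Fin 4 × Fin 4 → K, x ∈ W ↔
          ((∀ i j : Fin 4, j ≠ p → j ≠ q → x (i, j) = 0) ∧ x (m, p) = 0 ∧ x (m, q) = 0)) ∨
      (∃ p q m m' : Fin 4, p ≠ q ∧ m ≠ m' ∧ ∀ x : Fin 4 × Fin 4 → K, x ∈ W ↔
          ((∀ i j : Fin 4, j ≠ p → j ≠ q → x (i, j) = 0) ∧ x (m, q) = 0 ∧ x (m', q) = 0)))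
    (h10 : finrank K (LinearMap.range bL) = 10) : False := by
  classical
  exact false_of_rank_ten_of_list_of_isAlgClosed_m28 hD hDs bL CL hCs hκ hi hii hiii hN
    (fun x hx r c hr hc => subperm_vanish_inj_of_succAbove x (hV4 x (LinearMap.mem_ker.2 hx))
      r c hr hc) hlist hrn h10 (by omega)
end Summit.ValiantsHypothesis.ValiantsHypothesis.Theorems.SymPencilSdcPerFourCellTenSeven
end
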